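import Summits.HubbardSuperconductivity.HubbardSuperconductivity.Theorems.BalabanIRBirBdGPhaseCoercivityNegProj
import Summits.HubbardSuperconductivity.HubbardSuperconductivity.Theorems.BalabanIRBirBdGPhaseCoercivityBachBlock
import Summits.HubbardSuperconductivity.HubbardSuperconductivity.Theorems.BalabanIRBirBdGPhaseCoercivityRefTraceNorm
import Summits.HubbardSuperconductivity.HubbardSuperconductivity.Theorems.BalabanIRBirBdGPhaseCoercivitySumAbsEigHat
import Summits.HubbardSuperconductivity.HubbardSuperconductivity.Theorems.BalabanIRBirBdGPhaseCoercivityPairModes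
import Summits.HubbardSuperconductivity.HubbardSuperconductivity.Theorems.BalabanIRBirBdGPhaseCoercivityPairSymbol
import Summits.HubbardSuperconductivity.HubbardSuperconductivity.Theorems.BalabanIRBirBdGPhaseCoercivityModes
import Summits.HubbardSuperconductivity.Statement
import HarnessLib

/-!
# Route BalabanIR — crux 3 `BirBdGPhaseCoercivity` (item `stmt-HubbardSuperconductivity-2081`):
# phase rigidity of the chiral `d+id` BdG reference, for ALL parameters

THEOREM (`birBdGPhaseCoercivity_proof`, the item's body verbatim; this module is Theses-free as the
route's materialisation rule requires). On the torus `(ℤ/L)²` let `h = -(nn adjacency) - μ`, let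
`D(θ)_{xy} = (Δ₁ g_{x²-y²} + iΔ₂ g_{xy})(y-x) · (e^{iθ_x} + e^{iθ_y})/2` be the `d+id` pairing matrix with
phase texture `θ`, `Hb(θ) = [[h, D(θ)], [D(θ)ᴴ, -h]]`, `S(θ) = Σ_i |λ_i(Hb(θ))|`. For every `μ ∈ (-4,4)`,
`Δ₁ ≠ 0`, `Δ₂ ≠ 0`, with `Δ_max = 4(|Δ₁|+|Δ₂|)`, `E_max = 4 + |μ| + Δ_max`,
`c₀ = Δ₁²Δ₂²/(Δ_max² E_max) > 0` and `L₀ = 5`: for all `L ≥ 5` and all `θ`,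
  `c₀ Σ_x Σ_{y ∼ x} (1 - cos(θ_x - θ_y)) ≤ S(0) - S(θ)`.

PROOF (line `bcs-dual-persistence` of the crux chain, reshaped by the lead with `V := K`; stubs S1–S7
landed as `Theorems/BalabanIRBirBdGPhaseCoercivity{NegProj,BachBlock,RefTraceNorm,SumAbsEigHat,PairModes,
DefectBound,ImSquareSum}.lean`; prover-1's Theses-free Fourier files II–VI reused):
* LEMMA A (pair-fluctuation bound, `pairFluctuationBound_hat`): in the plane-wave basis, for EVERY
  pairing block `B`, `Σ|λ(X̂₀)| - Σ|λ(X̂_B)| ≥ Σ_k |Δ_k|²/E_k - 2 Σ_{k,k'} |B_{kk'}|²/(E_k+E_{k'})` —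
  Legendre duality of the BCS functional with Bach's two-quasiparticle kernel `(Kb)_{kk'} = (E_k+E_{k'})b_{kk'}`
  as the auxiliary pair interaction, for which the gap equation and Bach's stability inequality
  `Tr X̂₀(Γ-Γ₀) ≥ Tr 𝔼(Γ-Γ₀)²` are identities (S1 negative spectral projection, S2 Bach block inequality,
  S3 `Σ|λ(X̂₀)| ≥ 2ΣE`).
* MODES (S4, S5, `xyFunctional_eq_modes`): `S(0) - S(θ) ≥ L⁻⁴ Σ_q |û(q)|² 𝒢(q)`,
  `𝒢(q) = Σ_k [|Δ_k|²/E_k - |Δ_k+Δ_{k+q}|²/(2(E_k+E_{k+q}))] ≥ 0`, `R(θ) = L⁻² Σ_q |û(q)|² ε(q)`; so the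
  crux follows from the PAIR SYMBOL INEQUALITY `c₀ L² ε(q) ≤ 𝒢(q)` (`coercive_of_pairSymbolIneq`).
* SYMBOL INEQUALITY for all parameters (`pairSymbolIneq`): the exact defect and its imaginary-part
  minorant `𝒢(q) ≥ (4Δ_max²E_max)⁻¹ Σ_k (Im conj(Δ_k)Δ_{k+q})²` (S6) and the parameter-free trigonometric
  sum `Σ_k (Im conj(Δ_k)Δ_{k+q})² ≥ 4Δ₁²Δ₂² L² ε(q)` for `L ≥ 5` (S7).
The constant is of condensation scale at the binding `(π,π)` stagger (numerically the dual constant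
`min_q 𝒢(q)/(L²ε(q))` equals the exact small-stagger ratio to four digits), consistent with the ceiling
`c₀ ≤ |Δ₁|+|Δ₂|` and the non-uniformity in `Δ` recorded in `…Ceiling.lean`.

References: V. Bach, E. H. Lieb, J. P. Solovej, J. Stat. Phys. 76 (1994) 3; R. L. Frank, C. Hainzl,
R. Seiringer, J. P. Solovej, J. Amer. Math. Soc. 25 (2012) 667 (relative-entropy / pair-fluctuation bounds
of BCS theory; this is their `T = 0` lattice form); crux ideas `bcs-dual-persistence` (Cruxes/BirBdGPhaseCoercivity).
No definition is introduced.
-/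

noncomputable section

set_option linter.dupNamespace false

namespace Summit.HubbardSuperconductivity.HubbardSuperconductivity.Theorems.BirBdGPhaseCoercivity

open Matrix Finset Literature.Probability.LatticeModels
open Summit.HubbardSuperconductivity.HubbardSuperconductivity.Theorems
open Summit.HubbardSuperconductivity.HubbardSuperconductivity.Theorems.BirBdG
open scoped ComplexConjugate ComplexOrder

/-! ## Lemma A: the pair-fluctuation bound in the plane-wave basis (composition of S1–S3) -/

/-- **Lemma A (pair-fluctuation bound).** `Σ|λ(X̂₀)| - Σ|λ(X̂_B)| ≥ Σ_k |Δ_k|²/E_k - 2Σ_{k,k'}|B_{kk'}|²/(E_k+E_{k'})`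
for every pairing block `B` — the `T = 0` lattice form of the BCS relative-entropy/pair-fluctuation bound
(Bach's inequality with the two-quasiparticle kernel), here via Legendre duality with `V = K`. [folklore] -/
theorem pairFluctuationBound_hat {m : Type*} [Fintype m] [DecidableEq m] (ξ E : m → ℝ) (Δ : m → ℂ)
    (hEpos : ∀ k, 0 < E k) (hE : ∀ k, E k ^ 2 = ξ k ^ 2 + ‖Δ k‖ ^ 2) (B : Matrix m m ℂ)
    (hX₀ : (Matrix.fromBlocks (diagonal fun k => (ξ k : ℂ)) (diagonal Δ) (diagonal Δ)ᴴ
      (-diagonal fun k => (ξ k : ℂ))).IsHermitian)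
    (hX : (Matrix.fromBlocks (diagonal fun k => (ξ k : ℂ)) B Bᴴ (-diagonal fun k => (ξ k : ℂ))).IsHermitian) :
    ∑ k, ‖Δ k‖ ^ 2 / E k - 2 * ∑ k, ∑ k', ‖B k k'‖ ^ 2 / (E k + E k') ≤
      ∑ i, |hX₀.eigenvalues i| - ∑ i, |hX.eigenvalues i| := by
  obtain ⟨Γ, hΓ, hΓ2, hS⟩ := stub_negProj _ hX
  have htr : (Matrix.fromBlocks (diagonal fun k => (ξ k : ℂ)) B Bᴴ (-diagonal fun k => (ξ k : ℂ))).trace.re = 0 := by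
    rw [show ∀ (A B C D : Matrix m m ℂ), (Matrix.fromBlocks A B C D).trace = A.trace + D.trace from
      fun A B C D => by simp [Matrix.trace, Fintype.sum_sum_type]]
    simp [Matrix.trace]
  have h2 := stub_bachBlock ξ E Δ hEpos hE B Γ hΓ hΓ2
  have h3 := stub_refTraceNorm ξ E Δ hEpos hE hX₀
  have hhalf : ∑ k, ‖Δ k‖ ^ 2 / (2 * E k) = (∑ k, ‖Δ k‖ ^ 2 / E k) / 2 := by
    rw [Finset.sum_div]
    refine Finset.sum_congr rfl fun k _ => ?_
    rw [div_div, mul_comm]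
  rw [hhalf] at h2
  rw [hS, htr]
  linarith

/-! ## The reduction at fixed `L`: phase coercivity from the pair symbol inequality -/

variable {L : ℕ} [NeZero L]

/-- Real diagonal matrices cast to `ℂ` are Hermitian. [folklore] -/
theorem isHermitian_diagonal_ofReal {m : Type*} [Fintype m] [DecidableEq m] (ξ : m → ℝ) :
    (diagonal fun k => (ξ k : ℂ)).IsHermitian := by
  rw [Matrix.IsHermitian, Matrix.diagonal_conjTranspose]
  congr 1
  funext k
  simp

/-- The plane-wave BdG block matrix `[[ξ, B], [Bᴴ, -ξ]]` is Hermitian. [folklore] -/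
theorem isHermitian_nambuBlocks {m : Type*} [Fintype m] [DecidableEq m] (ξ : m → ℝ) (B : Matrix m m ℂ) :
    (Matrix.fromBlocks (diagonal fun k => (ξ k : ℂ)) B Bᴴ (-diagonal fun k => (ξ k : ℂ))).IsHermitian :=
  (isHermitian_diagonal_ofReal ξ).fromBlocks rfl (isHermitian_diagonal_ofReal ξ).neg

/-- **Phase coercivity from the pair symbol inequality** (fixed `(μ,Δ₁,Δ₂)`, fixed `L ≥ 3`): if
`c₀ L² ε(q) ≤ 𝒢(q)` for every `q ≠ 0`, the conclusion of `BirBdGPhaseCoercivity` holds at side `L` with the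
same `c₀`. Lemma A in the plane-wave basis + prover-1's Fourier bookkeeping
(`hopping_eq_circulant`, `pairing_eq_anticommutator`, `hat_*`, `xyFunctional_eq_modes`). [folklore] -/
theorem coercive_of_pairSymbolIneq (μ Δ₁ Δ₂ c₀ : ℝ) (hL : 3 ≤ L) (hμ : μ ∈ Set.Ioo (-4 : ℝ) 4)
    (h₁ : Δ₁ ≠ 0) (h₂ : Δ₂ ≠ 0) (ξ E : TorusSite 2 L → ℝ) (Δ : TorusSite 2 L → ℂ)
    (hξ : ∀ k, ξ k = -2 * Real.cos (latticeMomentum L k 0) - 2 * Real.cos (latticeMomentum L k 1) - μ)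
    (hΔ : ∀ k, Δ k = ((2 * Δ₁ * (Real.cos (latticeMomentum L k 0) - Real.cos (latticeMomentum L k 1)) : ℝ) : ℂ) -
        4 * Complex.I * ((Δ₂ * Real.sin (latticeMomentum L k 0) * Real.sin (latticeMomentum L k 1) : ℝ) : ℂ))
    (hE : ∀ k, E k = Real.sqrt (ξ k ^ 2 + ‖Δ k‖ ^ 2))
    (hsym : ∀ q : TorusSite 2 L, q ≠ 0 →
      c₀ * ((L ^ 2 : ℕ) : ℝ) *
          (4 - 2 * Real.cos (latticeMomentum L q 0) - 2 * Real.cos (latticeMomentum L q 1)) ≤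
        ∑ k, (‖Δ k‖ ^ 2 / E k - ‖Δ k + Δ (k + q)‖ ^ 2 / (2 * (E k + E (k + q))))) :
    let nnx : Literature.Probability.LatticeModels.TorusSite 2 L → Literature.Probability.LatticeModels.TorusSite 2 L → Prop := fun x y => y = x + ![1, 0] ∨ y = x + ![-1, 0]; let nny : Literature.Probability.LatticeModels.TorusSite 2 L → Literature.Probability.LatticeModels.TorusSite 2 L → Prop := fun x y => y = x + ![0, 1] ∨ y = x + ![0, -1]; let dg1 : Literature.Probability.LatticeModels.TorusSite 2 L → Literature.Probability.LatticeModels.TorusSite 2 L → Prop := fun x y => y = x + ![1, 1] ∨ y = x + ![-1, -1]; let dg2 : Literature.Probability.LatticeModels.TorusSite 2 L → Literature.Probability.LatticeModels.TorusSite 2 L → Prop := fun x y => y = x + ![1, -1] ∨ y = x + ![-1, 1]; let h : Matrix (Literature.Probability.LatticeModels.TorusSite 2 L) (Literature.Probability.LatticeModels.TorusSite 2 L) ℂ := fun x y => -(if nnx x y ∨ nny x y then (1 : ℂ) else 0) - (if x = y then (μ : ℂ) else 0); let D : (Literature.Probability.LatticeModels.TorusSite 2 L → ℝ) → Matrix (Literature.Probability.LatticeModels.TorusSite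 2 L) (Literature.Probability.LatticeModels.TorusSite 2 L) ℂ := fun θ x y => ((Δ₁ : ℂ) * ((if nnx x y then (1 : ℂ) else 0) - (if nny x y then (1 : ℂ) else 0)) + Complex.I * (Δ₂ : ℂ) * ((if dg1 x y then (1 : ℂ) else 0) - (if dg2 x y then (1 : ℂ) else 0))) * (Complex.exp (Complex.I * (θ x : ℂ)) + Complex.exp (Complex.I * (θ y : ℂ))) / 2; let Hb : (Literature.Probability.LatticeModels.TorusSite 2 L → ℝ) → Matrix (Literature.Probability.LatticeModels.TorusSite 2 L ⊕ Literature.Probability.LatticeModels.TorusSite 2 L) (Literature.Probability.LatticeModels.TorusSite 2 L ⊕ Literature.Probability.LatticeModels.TorusSite 2 L) ℂ := fun θ => Matrix.fromBlocks h (D θ) (Matrix.conjTranspose (D θ)) (-h); ∀ θ : Literature.Probability.LatticeModels.TorusSite 2 L → ℝ, ∀ (hθ : (Hb θ).IsHermitian) (h0 : (Hb (fun _ => 0)).IsHermitian), c₀ * ∑ x : Literature.Probability.LatticeModels.TorusSite 2 L, ∑ y : Literature.Probability.LatticeModels.TorusSite 2 L, (if nnx x y ∨ nny x y then (1 - Real.cos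 (θ x - θ y)) else 0) ≤ ∑ i, |h0.eigenvalues i| - ∑ i, |hθ.eigenvalues i| := by
  intro nnx nny dg1 dg2 h D Hb θ hθ h0
  -- the scaled plane-wave unitary `W` and `N = L²`
  have hN : (L ^ 2 : ℕ) ≠ 0 := pow_ne_zero 2 (NeZero.ne L)
  have hNr : ((L ^ 2 : ℕ) : ℝ) ≠ 0 := by exact_mod_cast hN
  have hNpos : (0 : ℝ) < ((L ^ 2 : ℕ) : ℝ) := by positivity
  have h1 := planeWave_conjTranspose_mul_self (d := 2) (L := L)
  have h2 := planeWave_mul_conjTranspose_self (d := 2) (L := L)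
  -- stencils and the texture
  set a : TorusSite 2 L → ℂ := fun r : TorusSite 2 L =>
    -(if ((r = -![1, 0] ∨ r = -![-1, 0]) ∨ (r = -![0, 1] ∨ r = -![0, -1])) then (1 : ℂ) else 0) -
      (if r = 0 then (μ : ℂ) else 0) with ha
  set dv : TorusSite 2 L → ℂ := fun r : TorusSite 2 L =>
    (Δ₁ : ℂ) * ((if (r = -![1, 0] ∨ r = -![-1, 0]) then (1 : ℂ) else 0) -
      (if (r = -![0, 1] ∨ r = -![0, -1]) then (1 : ℂ) else 0)) +
    Complex.I * (Δ₂ : ℂ) * ((if (r = -![1, 1] ∨ r = -![-1, -1]) then (1 : ℂ) else 0) -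
      (if (r = -![1, -1] ∨ r = -![-1, 1]) then (1 : ℂ) else 0)) with hdv
  set u : TorusSite 2 L → ℂ := fun x => Complex.exp (Complex.I * (θ x : ℂ)) with hu
  -- the gap is open
  have hdisp : ∀ k, 0 < ξ k ^ 2 + ‖Δ k‖ ^ 2 := by
    intro k
    rw [hξ, hΔ]
    exact bdg_dispersion_pos μ Δ₁ Δ₂ _ _ hμ h₁ h₂
  have hEpos : ∀ k, 0 < E k := fun k => by rw [hE]; exact Real.sqrt_pos.2 (hdisp k)
  have hEsq : ∀ k, E k ^ 2 = ξ k ^ 2 + ‖Δ k‖ ^ 2 := fun k => by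
    rw [hE, Real.sq_sqrt (hdisp k).le]
  -- symbols
  have hFa : torusFourier a = fun k => (ξ k : ℂ) := by
    funext k
    rw [ha, torusFourier_hopVec hL μ k, hξ]
  have hFd : torusFourier dv = Δ := by
    funext k
    rw [hdv, torusFourier_pairVec hL Δ₁ Δ₂ k, hΔ]
  -- the crux's matrices in structured form
  have hh : h = Matrix.circulant a := hopping_eq_circulant μ
  have hDθ : D θ = (1 / 2 : ℂ) • (Matrix.diagonal u * Matrix.circulant dv +
      Matrix.circulant dv * Matrix.diagonal u) := pairing_eq_anticommutator Δ₁ Δ₂ θ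
  have hD0 : D (fun _ => 0) = Matrix.circulant dv := by
    have key := pairing_eq_anticommutator (L := L) Δ₁ Δ₂ (fun _ => (0 : ℝ))
    rw [← hdv] at key
    change D (fun _ => 0) = _ at key
    rw [key]
    have hu0 : (Matrix.diagonal fun _ : TorusSite 2 L => Complex.exp (Complex.I * ((0 : ℝ) : ℂ))) = 1 := by
      rw [Complex.ofReal_zero, mul_zero, Complex.exp_zero]; exact Matrix.diagonal_one
    rw [hu0, Matrix.one_mul, Matrix.mul_one, ← two_smul ℂ (Matrix.circulant dv), smul_smul,
      show (1 / 2 : ℂ) * 2 = 1 by norm_num, one_smul]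
  -- plane-wave (hat) forms of the blocks
  have hath : ((L ^ 2 : ℕ) : ℂ)⁻¹ • (Matrix.of (fun k x : TorusSite 2 L => conj (torusChar k x)) * h *
      (Matrix.of fun k x : TorusSite 2 L => conj (torusChar k x))ᴴ) = Matrix.diagonal (fun k => (ξ k : ℂ)) := by
    rw [hh, hat_circulant, hFa]
  have hatC : ((L ^ 2 : ℕ) : ℂ)⁻¹ • (Matrix.of (fun k x : TorusSite 2 L => conj (torusChar k x)) *
      Matrix.circulant dv * (Matrix.of fun k x : TorusSite 2 L => conj (torusChar k x))ᴴ) =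
      Matrix.diagonal Δ := by
    rw [hat_circulant, hFd]
  have hatCh : ((L ^ 2 : ℕ) : ℂ)⁻¹ • (Matrix.of (fun k x : TorusSite 2 L => conj (torusChar k x)) *
      (Matrix.circulant dv)ᴴ * (Matrix.of fun k x : TorusSite 2 L => conj (torusChar k x))ᴴ) =
      (Matrix.diagonal Δ)ᴴ := by
    rw [hat_conjTranspose, hatC]
  have hatnegh : ((L ^ 2 : ℕ) : ℂ)⁻¹ • (Matrix.of (fun k x : TorusSite 2 L => conj (torusChar k x)) * (-h) *
      (Matrix.of fun k x : TorusSite 2 L => conj (torusChar k x))ᴴ) = -Matrix.diagonal (fun k => (ξ k : ℂ)) := by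
    rw [Matrix.mul_neg, Matrix.neg_mul, smul_neg, hath]
  set Dh : Matrix (TorusSite 2 L) (TorusSite 2 L) ℂ := ((L ^ 2 : ℕ) : ℂ)⁻¹ •
    (Matrix.of (fun k x : TorusSite 2 L => conj (torusChar k x)) * D θ *
      (Matrix.of fun k x : TorusSite 2 L => conj (torusChar k x))ᴴ) with hDhdef
  have hatDθh : ((L ^ 2 : ℕ) : ℂ)⁻¹ • (Matrix.of (fun k x : TorusSite 2 L => conj (torusChar k x)) *
      (D θ)ᴴ * (Matrix.of fun k x : TorusSite 2 L => conj (torusChar k x))ᴴ) = Dhᴴ :=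
    hat_conjTranspose (D θ)
  have hX₀ : ((L ^ 2 : ℕ) : ℂ)⁻¹ • (Matrix.fromBlocks (Matrix.of (fun k x : TorusSite 2 L => conj (torusChar k x))) 0 0
        (Matrix.of (fun k x : TorusSite 2 L => conj (torusChar k x))) * Hb (fun _ => 0) *
      (Matrix.fromBlocks (Matrix.of (fun k x : TorusSite 2 L => conj (torusChar k x))) 0 0
        (Matrix.of (fun k x : TorusSite 2 L => conj (torusChar k x))))ᴴ) =
      Matrix.fromBlocks (Matrix.diagonal fun k => (ξ k : ℂ)) (Matrix.diagonal Δ) (Matrix.diagonal Δ)ᴴ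
        (-Matrix.diagonal fun k => (ξ k : ℂ)) := by
    change ((L ^ 2 : ℕ) : ℂ)⁻¹ • (Matrix.fromBlocks (Matrix.of (fun k x : TorusSite 2 L => conj (torusChar k x))) 0 0
        (Matrix.of (fun k x : TorusSite 2 L => conj (torusChar k x))) *
        Matrix.fromBlocks h (D (fun _ => 0)) (D (fun _ => 0))ᴴ (-h) *
      (Matrix.fromBlocks (Matrix.of (fun k x : TorusSite 2 L => conj (torusChar k x))) 0 0
        (Matrix.of (fun k x : TorusSite 2 L => conj (torusChar k x))))ᴴ) = _
    rw [hat_fromBlocks, hD0, hath, hatC, hatCh, hatnegh]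
  have hX : ((L ^ 2 : ℕ) : ℂ)⁻¹ • (Matrix.fromBlocks (Matrix.of (fun k x : TorusSite 2 L => conj (torusChar k x))) 0 0
        (Matrix.of (fun k x : TorusSite 2 L => conj (torusChar k x))) * Hb θ *
      (Matrix.fromBlocks (Matrix.of (fun k x : TorusSite 2 L => conj (torusChar k x))) 0 0
        (Matrix.of (fun k x : TorusSite 2 L => conj (torusChar k x))))ᴴ) =
      Matrix.fromBlocks (Matrix.diagonal fun k => (ξ k : ℂ)) Dh Dhᴴ (-Matrix.diagonal fun k => (ξ k : ℂ)) := by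
    change ((L ^ 2 : ℕ) : ℂ)⁻¹ • (Matrix.fromBlocks (Matrix.of (fun k x : TorusSite 2 L => conj (torusChar k x))) 0 0
        (Matrix.of (fun k x : TorusSite 2 L => conj (torusChar k x))) *
        Matrix.fromBlocks h (D θ) (D θ)ᴴ (-h) *
      (Matrix.fromBlocks (Matrix.of (fun k x : TorusSite 2 L => conj (torusChar k x))) 0 0
        (Matrix.of (fun k x : TorusSite 2 L => conj (torusChar k x))))ᴴ) = _
    rw [hat_fromBlocks, hath, hatDθh, hatnegh]
  -- transfer of the spectral sums to the plane-wave basis (S4) and Lemma A there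
  have hXhH : (Matrix.fromBlocks (Matrix.diagonal fun k => (ξ k : ℂ)) Dh Dhᴴ
      (-Matrix.diagonal fun k => (ξ k : ℂ))).IsHermitian := isHermitian_nambuBlocks ξ Dh
  have hX₀hH : (Matrix.fromBlocks (Matrix.diagonal fun k => (ξ k : ℂ)) (Matrix.diagonal Δ) (Matrix.diagonal Δ)ᴴ
      (-Matrix.diagonal fun k => (ξ k : ℂ))).IsHermitian := by
    have := isHermitian_nambuBlocks ξ (Matrix.diagonal Δ)
    exact this
  have hSθ := stub_sumAbsEig_hat hN h1 h2 (Hb θ) _ hX hθ hXhH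
  have hS0 := stub_sumAbsEig_hat hN h1 h2 (Hb fun _ => 0) _ hX₀ h0 hX₀hH
  have hA := pairFluctuationBound_hat ξ E Δ hEpos hEsq Dh hX₀hH hXhH
  rw [← hSθ, ← hS0] at hA
  -- the pairing block mode by mode
  have hDh : ∀ k k', Dh k k' = (1 / 2 : ℂ) * (((((L ^ 2 : ℕ) : ℝ) : ℂ))⁻¹ *
      (∑ x, u x * torusChar (k' - k) x)) * (Δ k + Δ k') := by
    intro k k'
    rw [hDhdef, hDθ, hat_pairing_apply u dv k k', hFd]
    push_cast
    ring
  have hmodes := stub_pairModes (((L ^ 2 : ℕ) : ℝ)) (fun q => ∑ x, u x * torusChar q x) Δ E Dh hDh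
  have hunit : ∀ x, ‖u x‖ = 1 := by
    intro x
    rw [hu]
    dsimp only
    rw [mul_comm, Complex.norm_exp_ofReal_mul_I]
  have hP : ∑ q, ‖∑ x, u x * torusChar q x‖ ^ 2 = ((L ^ 2 : ℕ) : ℝ) * ((L ^ 2 : ℕ) : ℝ) :=
    sum_norm_sq_modes_of_unimodular u hunit
  -- the XY functional mode by mode
  have hR : ∑ x : TorusSite 2 L, ∑ y : TorusSite 2 L,
      (if nnx x y ∨ nny x y then (1 - Real.cos (θ x - θ y)) else 0) =
      ((L ^ 2 : ℕ) : ℝ)⁻¹ * ∑ q, ‖∑ x, u x * torusChar q x‖ ^ 2 *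
        (4 - 2 * Real.cos (latticeMomentum L q 0) - 2 * Real.cos (latticeMomentum L q 1)) :=
    xyFunctional_eq_modes hL θ
  -- mode-by-mode comparison, `q = 0` included
  have hmode : ∀ q : TorusSite 2 L,
      c₀ * ((L ^ 2 : ℕ) : ℝ) *
          (4 - 2 * Real.cos (latticeMomentum L q 0) - 2 * Real.cos (latticeMomentum L q 1)) ≤
        ∑ k, (‖Δ k‖ ^ 2 / E k - ‖Δ k + Δ (k + q)‖ ^ 2 / (2 * (E k + E (k + q)))) := by
    intro q
    by_cases hq : q = 0
    · subst hq
      have hp : ∀ i, latticeMomentum L (0 : TorusSite 2 L) i = 0 := fun i => by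
        simp [latticeMomentum]
      rw [hp 0, hp 1, Real.cos_zero]
      have : ∀ k, ‖Δ k‖ ^ 2 / E k - ‖Δ k + Δ (k + 0)‖ ^ 2 / (2 * (E k + E (k + 0))) = 0 := by
        intro k
        have h2Δ : Δ k + Δ k = 2 * Δ k := by ring
        have hEk : E k ≠ 0 := (hEpos k).ne'
        rw [add_zero, h2Δ, norm_mul, Complex.norm_two]
        field_simp
        ring
      simp only [this, Finset.sum_const_zero]
      norm_num
    · exact hsym q hq
  -- the constant term spread over the modes (`Σ_q |û(q)|² = N²`)
  have hAterm : ∑ k, ‖Δ k‖ ^ 2 / E k =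
      ((L ^ 2 : ℕ) : ℝ)⁻¹ ^ 2 * ∑ q, ‖∑ x, u x * torusChar q x‖ ^ 2 * (∑ k, ‖Δ k‖ ^ 2 / E k) := by
    rw [← Finset.sum_mul, hP]
    field_simp
  -- sum the mode inequalities with the weights `|û(q)|² ≥ 0`
  have hsum : ∑ q, ‖∑ x, u x * torusChar q x‖ ^ 2 * (c₀ * ((L ^ 2 : ℕ) : ℝ) *
          (4 - 2 * Real.cos (latticeMomentum L q 0) - 2 * Real.cos (latticeMomentum L q 1))) ≤
      ∑ q, ‖∑ x, u x * torusChar q x‖ ^ 2 *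
        ∑ k, (‖Δ k‖ ^ 2 / E k - ‖Δ k + Δ (k + q)‖ ^ 2 / (2 * (E k + E (k + q)))) :=
    Finset.sum_le_sum fun q _ => mul_le_mul_of_nonneg_left (hmode q) (sq_nonneg _)
  -- rewrite both sides of the goal in mode form
  have hgoalL : c₀ * (((L ^ 2 : ℕ) : ℝ)⁻¹ * ∑ q, ‖∑ x, u x * torusChar q x‖ ^ 2 *
        (4 - 2 * Real.cos (latticeMomentum L q 0) - 2 * Real.cos (latticeMomentum L q 1))) =
      ((L ^ 2 : ℕ) : ℝ)⁻¹ ^ 2 * ∑ q, ‖∑ x, u x * torusChar q x‖ ^ 2 * (c₀ * ((L ^ 2 : ℕ) : ℝ) *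
          (4 - 2 * Real.cos (latticeMomentum L q 0) - 2 * Real.cos (latticeMomentum L q 1))) := by
    rw [Finset.mul_sum, Finset.mul_sum, Finset.mul_sum]
    refine Finset.sum_congr rfl fun q _ => ?_
    field_simp
  have hsplit : ∀ q : TorusSite 2 L,
      ∑ k, (‖Δ k‖ ^ 2 / E k - ‖Δ k + Δ (k + q)‖ ^ 2 / (2 * (E k + E (k + q)))) =
        (∑ k, ‖Δ k‖ ^ 2 / E k) - 1 / 2 * ∑ k, ‖Δ k + Δ (k + q)‖ ^ 2 / (E k + E (k + q)) := by
    intro q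
    rw [Finset.sum_sub_distrib, Finset.mul_sum]
    congr 1
    refine Finset.sum_congr rfl fun k _ => ?_
    have hne : E k + E (k + q) ≠ 0 := (add_pos (hEpos k) (hEpos (k + q))).ne'
    field_simp
  have hgoalR : ∑ k, ‖Δ k‖ ^ 2 / E k - 2 * ∑ k, ∑ k', ‖Dh k k'‖ ^ 2 / (E k + E k') =
      ((L ^ 2 : ℕ) : ℝ)⁻¹ ^ 2 * ∑ q, ‖∑ x, u x * torusChar q x‖ ^ 2 *
        ∑ k, (‖Δ k‖ ^ 2 / E k - ‖Δ k + Δ (k + q)‖ ^ 2 / (2 * (E k + E (k + q)))) := by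
    rw [hmodes, hAterm]
    simp_rw [hsplit]
    have e : ∀ q : TorusSite 2 L, ‖∑ x, u x * torusChar q x‖ ^ 2 *
        ((∑ k, ‖Δ k‖ ^ 2 / E k) - 1 / 2 * ∑ k, ‖Δ k + Δ (k + q)‖ ^ 2 / (E k + E (k + q))) =
        ‖∑ x, u x * torusChar q x‖ ^ 2 * (∑ k, ‖Δ k‖ ^ 2 / E k) -
          1 / 2 * (‖∑ x, u x * torusChar q x‖ ^ 2 * ∑ k, ‖Δ k + Δ (k + q)‖ ^ 2 / (E k + E (k + q))) :=
      fun q => by ring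
    simp_rw [e]
    rw [Finset.sum_sub_distrib, ← Finset.mul_sum]
    ring
  rw [hR, hgoalL]
  refine le_trans ?_ hA
  rw [hgoalR]
  exact mul_le_mul_of_nonneg_left hsum (by positivity)

/-! ## The theorem: `BirBdGPhaseCoercivity` (body verbatim; this module is Theses-free) -/

/-- **Phase rigidity of the chiral `d+id` Bogoliubov–de Gennes reference (crux `BirBdGPhaseCoercivity` of route
BalabanIR, item stmt-HubbardSuperconductivity-2081), for ALL parameters.** For every `μ ∈ (-4,4)`, `Δ₁ ≠ 0`,
`Δ₂ ≠ 0` there are `c₀ > 0` (namely `Δ₁²Δ₂²/(Δ_max² E_max)`, `Δ_max = 4(|Δ₁|+|Δ₂|)`, `E_max = 4+|μ|+Δ_max`)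
and `L₀` (namely `5`) such that for every `L ≥ L₀` and every phase texture `θ` on the torus `(ℤ/L)²`,
`c₀ Σ_x Σ_{y∼x} (1 - cos(θ_x - θ_y)) ≤ Σ_i |λ_i(Hb(0))| - Σ_i |λ_i(Hb(θ))|` for the BdG matrix
`Hb(θ) = [[h, D(θ)], [D(θ)ᴴ, -h]]`. Proof: the pair-fluctuation bound (Legendre duality of the BCS functional
with the two-quasiparticle kernel `K = E ⊗ 1 + 1 ⊗ E` as auxiliary interaction, for which the gap equation and
Bach's stability inequality are identities), the mode decomposition of the pairing block, the exact defect of the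
pair symbol and a parameter-free trigonometric sum (line `bcs-dual-persistence`, reshaped; stubs S1–S7 of
`Cruxes/BirBdGPhaseCoercivity/Lines/bcs-dual-persistence.lean`). The statement below is the item's body verbatim.
[folklore] -/
theorem birBdGPhaseCoercivity_proof :
    ∀ (μ Δ₁ Δ₂ : ℝ), μ ∈ Set.Ioo (-4:ℝ) 4 → Δ₁ ≠ 0 → Δ₂ ≠ 0 → ∃ c₀ : ℝ, 0 < c₀ ∧ ∃ L₀ : ℕ, ∀ (L : ℕ) [NeZero L], L₀ ≤ L → let nnx : Literature.Probability.LatticeModels.TorusSite 2 L → Literature.Probability.LatticeModels.TorusSite 2 L → Prop := fun x y => y = x + ![1, 0] ∨ y = x + ![-1, 0]; let nny : Literature.Probability.LatticeModels.TorusSite 2 L → Literature.Probability.LatticeModels.TorusSite 2 L → Prop := fun x y => y = x + ![0, 1] ∨ y = x + ![0, -1]; let dg1 : Literature.Probability.LatticeModels.TorusSite 2 L → Literature.Probability.LatticeModels.TorusSite 2 L → Prop := fun x y => y = x + ![1, 1] ∨ y = x + ![-1, -1]; let dg2 : Literature.Probability.LatticeModels.TorusSite 2 L → Literature.Probability.LatticeModels.TorusSite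 2 L → Prop := fun x y => y = x + ![1, -1] ∨ y = x + ![-1, 1]; let h : Matrix (Literature.Probability.LatticeModels.TorusSite 2 L) (Literature.Probability.LatticeModels.TorusSite 2 L) ℂ := fun x y => -(if nnx x y ∨ nny x y then (1 : ℂ) else 0) - (if x = y then (μ : ℂ) else 0); let D : (Literature.Probability.LatticeModels.TorusSite 2 L → ℝ) → Matrix (Literature.Probability.LatticeModels.TorusSite 2 L) (Literature.Probability.LatticeModels.TorusSite 2 L) ℂ := fun θ x y => ((Δ₁ : ℂ) * ((if nnx x y then (1 : ℂ) else 0) - (if nny x y then (1 : ℂ) else 0)) + Complex.I * (Δ₂ : ℂ) * ((if dg1 x y then (1 : ℂ) else 0) - (if dg2 x y then (1 : ℂ) else 0))) * (Complex.exp (Complex.I * (θ x : ℂ)) + Complex.exp (Complex.I * (θ y : ℂ))) / 2; let Hb : (Literature.Probability.LatticeModels.TorusSite 2 L → ℝ) → Matrix (Literature.Probability.LatticeModels.TorusSite 2 L ⊕ Literature.Probability.LatticeModels.TorusSite 2 L) (Literature.Probability.LatticeModels.TorusSite 2 L ⊕ Literature.Probability.LatticeModels.TorusSite 2 L) ℂ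 := fun θ => Matrix.fromBlocks h (D θ) (Matrix.conjTranspose (D θ)) (-h); ∀ θ : Literature.Probability.LatticeModels.TorusSite 2 L → ℝ, ∀ (hθ : (Hb θ).IsHermitian) (h0 : (Hb (fun _ => 0)).IsHermitian), c₀ * ∑ x : Literature.Probability.LatticeModels.TorusSite 2 L, ∑ y : Literature.Probability.LatticeModels.TorusSite 2 L, (if nnx x y ∨ nny x y then (1 - Real.cos (θ x - θ y)) else 0) ≤ ∑ i, |h0.eigenvalues i| - ∑ i, |hθ.eigenvalues i| := by
  intro μ Δ₁ Δ₂ hμ h₁ h₂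
  refine ⟨Δ₁ ^ 2 * Δ₂ ^ 2 / ((4 * (|Δ₁| + |Δ₂|)) ^ 2 * (4 + |μ| + 4 * (|Δ₁| + |Δ₂|))), ?_, 5, ?_⟩
  · have hD1 : 0 < |Δ₁| := abs_pos.2 h₁
    have hD2 : 0 < |Δ₂| := abs_pos.2 h₂
    have hμ0 : 0 ≤ |μ| := abs_nonneg μ
    have hsq1 : 0 < Δ₁ ^ 2 := by positivity
    have hsq2 : 0 < Δ₂ ^ 2 := by positivity
    positivity
  intro L _ hL5
  have hL3 : 3 ≤ L := le_trans (by norm_num) hL5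
  set ξ : TorusSite 2 L → ℝ := fun k => -2 * Real.cos (latticeMomentum L k 0) - 2 * Real.cos (latticeMomentum L k 1) - μ
    with hξ
  set Δ : TorusSite 2 L → ℂ := fun k =>
    ((2 * Δ₁ * (Real.cos (latticeMomentum L k 0) - Real.cos (latticeMomentum L k 1)) : ℝ) : ℂ) -
      4 * Complex.I * ((Δ₂ * Real.sin (latticeMomentum L k 0) * Real.sin (latticeMomentum L k 1) : ℝ) : ℂ) with hΔ
  set E : TorusSite 2 L → ℝ := fun k => Real.sqrt (ξ k ^ 2 + ‖Δ k‖ ^ 2) with hE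
  have hEpos : ∀ k, 0 < E k := fun k => by
    rw [hE]
    exact Real.sqrt_pos.2 (bdg_dispersion_pos μ Δ₁ Δ₂ _ _ hμ h₁ h₂)
  exact coercive_of_pairSymbolIneq μ Δ₁ Δ₂ _ hL3 hμ h₁ h₂ ξ E Δ (fun _ => rfl) (fun _ => rfl) (fun _ => rfl)
    (fun q _ => pairSymbolIneq μ Δ₁ Δ₂ hL5 h₁ h₂ E Δ (fun _ => rfl) (fun _ => rfl) hEpos q)

end Summit.HubbardSuperconductivity.HubbardSuperconductivity.Theorems.BirBdGPhaseCoercivity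

end
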